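import Summits.MatrixMultiplication.OmegaCensus.ThreeSetZ29Norm4514JoinK1Q5
import HarnessLib

/-!
# `(4,5,14)@841`: killer `1` (`[26, 27, 28, 28]`) admits no `X`-datum — block assembly (inlined statements), part `6` of `7`

ω-census `pub-omega`, family (b3), seat pub-omega-group gen 41.  Framing: lottery ticket; floor = certified bounds/negative ranges.
VALUE: part of the finite half of the kernel route for the census cell `(4,5,14)@841`: the leaf-block theorems of killer `1` (norm filter)
assembled over the leading-entry blocks of `compsLit 29 5` (`ZpZpDomino.compsLit.eq_2`); children first, then their parents.  NOT progress on ω.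
-/

namespace Summit.MatrixMultiplication.OmegaCensus

namespace Z29Norm4514

/-- Killer `1`, block `[0, 0, 0, 0, 0, 0, 0]` (65780 data): all refuted (by leading entry). [folklore] -/
theorem nk1i_b7 : ∀ Fl ∈ ((ZpZpDomino.compsLit 22 5).map (fun l => 0 :: 0 :: 0 :: 0 :: 0 :: 0 :: 0 :: l)), ∀ (G : ZMod 29 → ℕ) (s : ZMod 29), (∀ u, G u ≤ 14) →
    ¬ ∀ τ : ZMod 29, (∑ u : ZMod 29, lineMat3 (vecFn [0,0,0,0,0,0,0,0,0,0,0,0,0,0,0,0,0,0,0,0,0,0,0,0,0,0,1,1,2]) (vecFn Fl) τ u * G u) + (if s = τ then 1 else 0) = 29 := by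
  intro F hF
  rw [List.mem_map] at hF
  obtain ⟨F', hF', rfl⟩ := hF
  have hs : ZpZpDomino.compsLit 22 5 =
      (List.range (5 + 1)).flatMap (fun c => (ZpZpDomino.compsLit 21 (5 - c)).map fun l => c :: l) := by
    show ZpZpDomino.compsLit (21 + 1) 5 = _
    rw [ZpZpDomino.compsLit.eq_2]
  rw [hs, List.mem_flatMap] at hF'
  obtain ⟨c, hc, hF''⟩ := hF'
  rw [List.mem_range] at hc
  rw [List.mem_map] at hF''
  obtain ⟨F'', hmem, rfl⟩ := hF''
  interval_cases c
  · exact nk1i_b8 _ (List.mem_map.2 ⟨F'', hmem, rfl⟩)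
  · exact nk1i_b119 _ (List.mem_map.2 ⟨F'', hmem, rfl⟩)
  · exact nk1_b145 _ (List.mem_map.2 ⟨F'', hmem, rfl⟩)
  · exact nk1_b146 _ (List.mem_map.2 ⟨F'', hmem, rfl⟩)
  · exact nk1_b147 _ (List.mem_map.2 ⟨F'', hmem, rfl⟩)
  · exact nk1_b148 _ (List.mem_map.2 ⟨F'', hmem, rfl⟩)

/-- Killer `1`, block `[0, 0, 0, 0, 0, 0]` (80730 data): all refuted (by leading entry). [folklore] -/
theorem nk1i_b6 : ∀ Fl ∈ ((ZpZpDomino.compsLit 23 5).map (fun l => 0 :: 0 :: 0 :: 0 :: 0 :: 0 :: l)), ∀ (G : ZMod 29 → ℕ) (s : ZMod 29), (∀ u, G u ≤ 14) →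
    ¬ ∀ τ : ZMod 29, (∑ u : ZMod 29, lineMat3 (vecFn [0,0,0,0,0,0,0,0,0,0,0,0,0,0,0,0,0,0,0,0,0,0,0,0,0,0,1,1,2]) (vecFn Fl) τ u * G u) + (if s = τ then 1 else 0) = 29 := by
  intro F hF
  rw [List.mem_map] at hF
  obtain ⟨F', hF', rfl⟩ := hF
  have hs : ZpZpDomino.compsLit 23 5 =
      (List.range (5 + 1)).flatMap (fun c => (ZpZpDomino.compsLit 22 (5 - c)).map fun l => c :: l) := by
    show ZpZpDomino.compsLit (22 + 1) 5 = _
    rw [ZpZpDomino.compsLit.eq_2]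
  rw [hs, List.mem_flatMap] at hF'
  obtain ⟨c, hc, hF''⟩ := hF'
  rw [List.mem_range] at hc
  rw [List.mem_map] at hF''
  obtain ⟨F'', hmem, rfl⟩ := hF''
  interval_cases c
  · exact nk1i_b7 _ (List.mem_map.2 ⟨F'', hmem, rfl⟩)
  · exact nk1i_b149 _ (List.mem_map.2 ⟨F'', hmem, rfl⟩)
  · exact nk1_b180 _ (List.mem_map.2 ⟨F'', hmem, rfl⟩)
  · exact nk1_b181 _ (List.mem_map.2 ⟨F'', hmem, rfl⟩)
  · exact nk1_b182 _ (List.mem_map.2 ⟨F'', hmem, rfl⟩)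
  · exact nk1_b183 _ (List.mem_map.2 ⟨F'', hmem, rfl⟩)

/-- Killer `1`, block `[0, 0, 0, 0, 0]` (98280 data): all refuted (by leading entry). [folklore] -/
theorem nk1i_b5 : ∀ Fl ∈ ((ZpZpDomino.compsLit 24 5).map (fun l => 0 :: 0 :: 0 :: 0 :: 0 :: l)), ∀ (G : ZMod 29 → ℕ) (s : ZMod 29), (∀ u, G u ≤ 14) →
    ¬ ∀ τ : ZMod 29, (∑ u : ZMod 29, lineMat3 (vecFn [0,0,0,0,0,0,0,0,0,0,0,0,0,0,0,0,0,0,0,0,0,0,0,0,0,0,1,1,2]) (vecFn Fl) τ u * G u) + (if s = τ then 1 else 0) = 29 := by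
  intro F hF
  rw [List.mem_map] at hF
  obtain ⟨F', hF', rfl⟩ := hF
  have hs : ZpZpDomino.compsLit 24 5 =
      (List.range (5 + 1)).flatMap (fun c => (ZpZpDomino.compsLit 23 (5 - c)).map fun l => c :: l) := by
    show ZpZpDomino.compsLit (23 + 1) 5 = _
    rw [ZpZpDomino.compsLit.eq_2]
  rw [hs, List.mem_flatMap] at hF'
  obtain ⟨c, hc, hF''⟩ := hF'
  rw [List.mem_range] at hc
  rw [List.mem_map] at hF''
  obtain ⟨F'', hmem, rfl⟩ := hF''
  interval_cases c
  · exact nk1i_b6 _ (List.mem_map.2 ⟨F'', hmem, rfl⟩)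
  · exact nk1i_b184 _ (List.mem_map.2 ⟨F'', hmem, rfl⟩)
  · exact nk1_b220 _ (List.mem_map.2 ⟨F'', hmem, rfl⟩)
  · exact nk1_b221 _ (List.mem_map.2 ⟨F'', hmem, rfl⟩)
  · exact nk1_b222 _ (List.mem_map.2 ⟨F'', hmem, rfl⟩)
  · exact nk1_b223 _ (List.mem_map.2 ⟨F'', hmem, rfl⟩)

/-- Killer `1`, block `[0, 0, 0, 0]` (118755 data): all refuted (by leading entry). [folklore] -/
theorem nk1i_b4 : ∀ Fl ∈ ((ZpZpDomino.compsLit 25 5).map (fun l => 0 :: 0 :: 0 :: 0 :: l)), ∀ (G : ZMod 29 → ℕ) (s : ZMod 29), (∀ u, G u ≤ 14) →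
    ¬ ∀ τ : ZMod 29, (∑ u : ZMod 29, lineMat3 (vecFn [0,0,0,0,0,0,0,0,0,0,0,0,0,0,0,0,0,0,0,0,0,0,0,0,0,0,1,1,2]) (vecFn Fl) τ u * G u) + (if s = τ then 1 else 0) = 29 := by
  intro F hF
  rw [List.mem_map] at hF
  obtain ⟨F', hF', rfl⟩ := hF
  have hs : ZpZpDomino.compsLit 25 5 =
      (List.range (5 + 1)).flatMap (fun c => (ZpZpDomino.compsLit 24 (5 - c)).map fun l => c :: l) := by
    show ZpZpDomino.compsLit (24 + 1) 5 = _
    rw [ZpZpDomino.compsLit.eq_2]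
  rw [hs, List.mem_flatMap] at hF'
  obtain ⟨c, hc, hF''⟩ := hF'
  rw [List.mem_range] at hc
  rw [List.mem_map] at hF''
  obtain ⟨F'', hmem, rfl⟩ := hF''
  interval_cases c
  · exact nk1i_b5 _ (List.mem_map.2 ⟨F'', hmem, rfl⟩)
  · exact nk1i_b224 _ (List.mem_map.2 ⟨F'', hmem, rfl⟩)
  · exact nk1_b265 _ (List.mem_map.2 ⟨F'', hmem, rfl⟩)
  · exact nk1_b266 _ (List.mem_map.2 ⟨F'', hmem, rfl⟩)
  · exact nk1_b267 _ (List.mem_map.2 ⟨F'', hmem, rfl⟩)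
  · exact nk1_b268 _ (List.mem_map.2 ⟨F'', hmem, rfl⟩)

/-- Killer `1`, block `[0, 0, 0]` (142506 data): all refuted (by leading entry). [folklore] -/
theorem nk1i_b3 : ∀ Fl ∈ ((ZpZpDomino.compsLit 26 5).map (fun l => 0 :: 0 :: 0 :: l)), ∀ (G : ZMod 29 → ℕ) (s : ZMod 29), (∀ u, G u ≤ 14) →
    ¬ ∀ τ : ZMod 29, (∑ u : ZMod 29, lineMat3 (vecFn [0,0,0,0,0,0,0,0,0,0,0,0,0,0,0,0,0,0,0,0,0,0,0,0,0,0,1,1,2]) (vecFn Fl) τ u * G u) + (if s = τ then 1 else 0) = 29 := by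
  intro F hF
  rw [List.mem_map] at hF
  obtain ⟨F', hF', rfl⟩ := hF
  have hs : ZpZpDomino.compsLit 26 5 =
      (List.range (5 + 1)).flatMap (fun c => (ZpZpDomino.compsLit 25 (5 - c)).map fun l => c :: l) := by
    show ZpZpDomino.compsLit (25 + 1) 5 = _
    rw [ZpZpDomino.compsLit.eq_2]
  rw [hs, List.mem_flatMap] at hF'
  obtain ⟨c, hc, hF''⟩ := hF'
  rw [List.mem_range] at hc
  rw [List.mem_map] at hF''
  obtain ⟨F'', hmem, rfl⟩ := hF''
  interval_cases c
  · exact nk1i_b4 _ (List.mem_map.2 ⟨F'', hmem, rfl⟩)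
  · exact nk1i_b269 _ (List.mem_map.2 ⟨F'', hmem, rfl⟩)
  · exact nk1_b315 _ (List.mem_map.2 ⟨F'', hmem, rfl⟩)
  · exact nk1_b316 _ (List.mem_map.2 ⟨F'', hmem, rfl⟩)
  · exact nk1_b317 _ (List.mem_map.2 ⟨F'', hmem, rfl⟩)
  · exact nk1_b318 _ (List.mem_map.2 ⟨F'', hmem, rfl⟩)

/-- Killer `1`, block `[0, 0]` (169911 data): all refuted (by leading entry). [folklore] -/
theorem nk1i_b2 : ∀ Fl ∈ ((ZpZpDomino.compsLit 27 5).map (fun l => 0 :: 0 :: l)), ∀ (G : ZMod 29 → ℕ) (s : ZMod 29), (∀ u, G u ≤ 14) →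
    ¬ ∀ τ : ZMod 29, (∑ u : ZMod 29, lineMat3 (vecFn [0,0,0,0,0,0,0,0,0,0,0,0,0,0,0,0,0,0,0,0,0,0,0,0,0,0,1,1,2]) (vecFn Fl) τ u * G u) + (if s = τ then 1 else 0) = 29 := by
  intro F hF
  rw [List.mem_map] at hF
  obtain ⟨F', hF', rfl⟩ := hF
  have hs : ZpZpDomino.compsLit 27 5 =
      (List.range (5 + 1)).flatMap (fun c => (ZpZpDomino.compsLit 26 (5 - c)).map fun l => c :: l) := by
    show ZpZpDomino.compsLit (26 + 1) 5 = _
    rw [ZpZpDomino.compsLit.eq_2]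
  rw [hs, List.mem_flatMap] at hF'
  obtain ⟨c, hc, hF''⟩ := hF'
  rw [List.mem_range] at hc
  rw [List.mem_map] at hF''
  obtain ⟨F'', hmem, rfl⟩ := hF''
  interval_cases c
  · exact nk1i_b3 _ (List.mem_map.2 ⟨F'', hmem, rfl⟩)
  · exact nk1i_b319 _ (List.mem_map.2 ⟨F'', hmem, rfl⟩)
  · exact nk1_b370 _ (List.mem_map.2 ⟨F'', hmem, rfl⟩)
  · exact nk1_b371 _ (List.mem_map.2 ⟨F'', hmem, rfl⟩)
  · exact nk1_b372 _ (List.mem_map.2 ⟨F'', hmem, rfl⟩)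
  · exact nk1_b373 _ (List.mem_map.2 ⟨F'', hmem, rfl⟩)

/-- Killer `1`, block `[0]` (201376 data): all refuted (by leading entry). [folklore] -/
theorem nk1i_b1 : ∀ Fl ∈ ((ZpZpDomino.compsLit 28 5).map (fun l => 0 :: l)), ∀ (G : ZMod 29 → ℕ) (s : ZMod 29), (∀ u, G u ≤ 14) →
    ¬ ∀ τ : ZMod 29, (∑ u : ZMod 29, lineMat3 (vecFn [0,0,0,0,0,0,0,0,0,0,0,0,0,0,0,0,0,0,0,0,0,0,0,0,0,0,1,1,2]) (vecFn Fl) τ u * G u) + (if s = τ then 1 else 0) = 29 := by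
  intro F hF
  rw [List.mem_map] at hF
  obtain ⟨F', hF', rfl⟩ := hF
  have hs : ZpZpDomino.compsLit 28 5 =
      (List.range (5 + 1)).flatMap (fun c => (ZpZpDomino.compsLit 27 (5 - c)).map fun l => c :: l) := by
    show ZpZpDomino.compsLit (27 + 1) 5 = _
    rw [ZpZpDomino.compsLit.eq_2]
  rw [hs, List.mem_flatMap] at hF'
  obtain ⟨c, hc, hF''⟩ := hF'
  rw [List.mem_range] at hc
  rw [List.mem_map] at hF''
  obtain ⟨F'', hmem, rfl⟩ := hF''
  interval_cases c
  · exact nk1i_b2 _ (List.mem_map.2 ⟨F'', hmem, rfl⟩)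
  · exact nk1i_b374 _ (List.mem_map.2 ⟨F'', hmem, rfl⟩)
  · exact nk1_b430 _ (List.mem_map.2 ⟨F'', hmem, rfl⟩)
  · exact nk1_b431 _ (List.mem_map.2 ⟨F'', hmem, rfl⟩)
  · exact nk1_b432 _ (List.mem_map.2 ⟨F'', hmem, rfl⟩)
  · exact nk1_b433 _ (List.mem_map.2 ⟨F'', hmem, rfl⟩)

/-- Killer `1`, block `[]` (237336 data): all refuted (by leading entry). [folklore] -/
theorem nk1i_b0 : ∀ Fl ∈ (ZpZpDomino.compsLit 29 5), ∀ (G : ZMod 29 → ℕ) (s : ZMod 29), (∀ u, G u ≤ 14) →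
    ¬ ∀ τ : ZMod 29, (∑ u : ZMod 29, lineMat3 (vecFn [0,0,0,0,0,0,0,0,0,0,0,0,0,0,0,0,0,0,0,0,0,0,0,0,0,0,1,1,2]) (vecFn Fl) τ u * G u) + (if s = τ then 1 else 0) = 29 := by
  intro F hF
  have hs : ZpZpDomino.compsLit 29 5 =
      (List.range (5 + 1)).flatMap (fun c => (ZpZpDomino.compsLit 28 (5 - c)).map fun l => c :: l) := by
    show ZpZpDomino.compsLit (28 + 1) 5 = _
    rw [ZpZpDomino.compsLit.eq_2]
  rw [hs, List.mem_flatMap] at hF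
  obtain ⟨c, hc, hF''⟩ := hF
  rw [List.mem_range] at hc
  rw [List.mem_map] at hF''
  obtain ⟨F'', hmem, rfl⟩ := hF''
  interval_cases c
  · exact nk1i_b1 _ (List.mem_map.2 ⟨F'', hmem, rfl⟩)
  · exact nk1i_b434 _ (List.mem_map.2 ⟨F'', hmem, rfl⟩)
  · exact nk1i_b495 _ (List.mem_map.2 ⟨F'', hmem, rfl⟩)
  · exact nk1_b500 _ (List.mem_map.2 ⟨F'', hmem, rfl⟩)
  · exact nk1_b501 _ (List.mem_map.2 ⟨F'', hmem, rfl⟩)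
  · exact nk1_b502 _ (List.mem_map.2 ⟨F'', hmem, rfl⟩)

/-- **Killer `1` (`[26, 27, 28, 28]`): every `X`-datum of mass `5` is refuted.** [folklore] -/
theorem killer1_all : ∀ Fl ∈ ZpZpDomino.compsLit 29 5, ∀ (G : ZMod 29 → ℕ) (s : ZMod 29), (∀ u, G u ≤ 14) →
    ¬ ∀ τ : ZMod 29, (∑ u : ZMod 29, lineMat3 (vecFn [0,0,0,0,0,0,0,0,0,0,0,0,0,0,0,0,0,0,0,0,0,0,0,0,0,0,1,1,2]) (vecFn Fl) τ u * G u) + (if s = τ then 1 else 0) = 29 := nk1i_b0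

end Z29Norm4514

end Summit.MatrixMultiplication.OmegaCensus
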